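import Mathlib
import HarnessLib
import Summits.Ventures.LatticeQCDFlow.Exactness.SU2WilsonFlowLOLeapfrogEnergyError
import Summits.Ventures.LatticeQCDFlow.Exactness.SU2LeapfrogMeanAcceptance
import Summits.Ventures.LatticeQCDFlow.Exactness.SU2WilsonFlowLOMemberContinuity
import Summits.Ventures.LatticeQCDFlow.Exactness.WilsonHeatBathErgodic

/-!
# THE MEAN ACCEPTANCE OF FT-HMC THROUGH THE `SU(2)` LO WILSON-FLOW MEMBER WITH THE EXACT FORCE AS RUN IS `≥ 1 − O(nε'²)`: the pointwise «acceptance vs step size» law averaged over the momentum refresh — any torus and schedule, and the row's 4⁴ acceptance configuration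

HONEST FRAMING: exact (Metropolis-corrected) sampling algorithms for lattice gauge theory;
figures of merit are autocorrelation/cost numbers at stated couplings and volumes; no
continuum-physics claim.

Venture `LatticeQCDFlow` (cell pub-lqcd), topic `Exactness`; FANOUT row 14 (`eng-flowhmc`, engine
`latflow.fthmc`, family B; the row's acceptance test reports the MEAN Metropolis acceptance of FT-HMC through the LO
member on the 4⁴ `SU(2)` lattice with the force by autodiff).  NEW WORK of the cell — the assembly:
`SU2LeapfrogMeanAcceptance` (`su2LeapfrogProposalN_meanAcceptance_ge`: for ANY measurable action with a measurable,
bounded, matrix-sup-Lipschitz coordinate gradient the refresh-averaged acceptance is `≥ 1 − n·K|ε|·(…moments…)`),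
`SU2WilsonFlowLOLeapfrogEnergyError` §1 (the chain rule in the step size `D^ε S = ε·D¹S`),
`SU2WilsonFlowLOExactForceRegular` (`su2WilsonFlowLO_exactForce_regular`: `Φ₁ = D¹S̃` is measurable, bounded, Lipschitz —
compactness constants `Φ_max, K_Φ`), `SU2ExactForceCovering` (differentiability along the Pauli drift),
`SU2WilsonFlowLOMemberContinuity` + `WilsonHeatBathErgodic` (`S̃` is continuous, hence measurable),
`SU2WilsonFlowLOAcceptanceLattice` (the 4⁴ packaging); nothing is cited as a fact; no number.

* §1 **`su2LeapfrogProposalN_meanAcceptance_ge_of_unitGrad`** — generic: ANY measurable action `S` with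
  `a ↦ S(exp(a)·W)` differentiable at `0` and a MEASURABLE unit-step gradient `D¹S` with `‖D¹S(W)_l‖ ≤ B`,
  `‖D¹S(W) − D¹S(W')‖ ≤ K‖coeConfig W − coeConfig W'‖`; drift `e_{ε'}`, kinetic coefficient `κ' > 0`, consistent half kick
  `−(ε'/(4κ'))·D¹S`: from EVERY `q`,
  `∫ min(1, e^{−ΔH(q,p)}) d(su2MomentumLaw κ')(p) ≥ 1 − n·(|ε'|K)·|ε'|·(8|ι|²·3/(2κ') + (8b + 8c₁ + c₂)·|ι|·2/√(πκ') + b(8c₁ + c₂))`,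
  `b = (2n+1)|ε'|B/(4κ')`, `c₁ = (2n+1)|ι||ε'|B/(4κ')`, `c₂ = |ι||ε'|B/κ'` — EXPLICITLY `O(nε'²)`.
* §2 **`su2WilsonFlowLO_exactForce_meanAcceptance_ge`** — THE LO MEMBER: torus `(ℤ/L)^d`, colouring `χ`, ANY schedule
  (layers VERBATIM, positive densities), every `β`, `κ' > 0`: there are `Φ_max, K_Φ ≥ 0` such that for EVERY `n`, `ε'`,
  `q` the refresh-averaged acceptance of the engine's `n`-step proposal with the exact force at scale `1` and the
  consistent half kick obeys the §1 bound with `B = Φ_max`, `K = K_Φ`.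
* §3 **`su2_fthmcN_acceptanceLattice_exactForce_meanAcceptance_ge`** — THE ROW'S ACCEPTANCE CONFIGURATION (4⁴ `SU(2)`, a
  parity colouring, Lüscher's schedule of `8·nsweeps` sub-steps, `6|ε| < 1`): the same.

NOT CLAIMED: any value of `Φ_max`, `K_Φ` (compactness); the measured acceptance NUMBER (the row's test is measured, this
is its typed lower bound as a law in `ε'`, `n`); the learned member (same assembly with `SU2ResidualExactForceRegular`);
floating point; any number.
-/

noncomputable section

namespace Summit.Ventures.LatticeQCDFlow.Exactness

open Set Function MeasureTheory NormedSpace InnerProductGeometry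
open Literature.MathematicalPhysics.QuantumFieldTheory
open Literature.MathematicalPhysics.QuantumFieldTheory.Balaban1983to89.B10Eq18SigmaSU2Haar (expPauli)
open scoped Matrix Matrix.Norms.Operator InnerProductSpace ENNReal

set_option backward.isDefEq.respectTransparency false

variable {ι : Type*}

/-! ## §1 The mean acceptance for a kernel driven by a measurable, bounded, matrix-sup-Lipschitz unit-step gradient -/

section UnitForce

variable [Fintype ι] [DecidableEq ι]

/-- **THE MEAN ACCEPTANCE IS `≥ 1 − O(nε'²)` FOR A KERNEL DRIVEN BY THE UNIT-STEP GRADIENT** (the format in which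
the tree delivers the exact force `Φ₁` of the two members). -/
theorem su2LeapfrogProposalN_meanAcceptance_ge_of_unitGrad (S : (ι → Matrix.specialUnitaryGroup (Fin 2) ℂ) → ℝ)
    (ε κ' : ℝ) (hκ' : 0 < κ') (hS : Measurable S)
    (hd1 : ∀ W : ι → Matrix.specialUnitaryGroup (Fin 2) ℂ,
      DifferentiableAt ℝ (fun a : ι → EuclideanSpace ℝ (Fin 3) => S ((fun l : ι => expPauli (a l)) * W)) 0)
    {B K : ℝ} (hB0 : 0 ≤ B) (hK0 : 0 ≤ K)
    (hm1 : Measurable fun (W : ι → Matrix.specialUnitaryGroup (Fin 2) ℂ) (l : ι) =>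
      WithLp.toLp 2 (fun i : Fin 3 => fderiv ℝ (fun a : ι → EuclideanSpace ℝ (Fin 3) => S ((fun l : ι => expPauli (a l)) * W)) 0
        (Pi.single l (EuclideanSpace.single i (1 : ℝ)))))
    (hb : ∀ (W : ι → Matrix.specialUnitaryGroup (Fin 2) ℂ) (l : ι),
      ‖WithLp.toLp 2 (fun i : Fin 3 => fderiv ℝ (fun a : ι → EuclideanSpace ℝ (Fin 3) => S ((fun l : ι => expPauli (a l)) * W)) 0
        (Pi.single l (EuclideanSpace.single i (1 : ℝ))))‖ ≤ B)
    (hK : ∀ W W' : ι → Matrix.specialUnitaryGroup (Fin 2) ℂ,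
      ‖(fun l : ι => WithLp.toLp 2 (fun i : Fin 3 => fderiv ℝ (fun a : ι → EuclideanSpace ℝ (Fin 3) => S ((fun l : ι => expPauli (a l)) * W)) 0
          (Pi.single l (EuclideanSpace.single i (1 : ℝ))))) -
        (fun l : ι => WithLp.toLp 2 (fun i : Fin 3 => fderiv ℝ (fun a : ι → EuclideanSpace ℝ (Fin 3) => S ((fun l : ι => expPauli (a l)) * W')) 0
          (Pi.single l (EuclideanSpace.single i (1 : ℝ)))))‖ ≤ K * ‖coeConfig W - coeConfig W'‖)
    (q : ι → Matrix.specialUnitaryGroup (Fin 2) ℂ) (n : ℕ) :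
    1 - n * ((|ε| * K) * |ε|) *
        (8 * ((Fintype.card ι : ℝ) ^ 2 * (3 / (2 * κ'))) +
          (8 * ((2 * n + 1) * (|ε| * B / (4 * κ'))) + 8 * ((2 * n + 1) * (Fintype.card ι * (|ε| * B / (4 * κ')))) +
              Fintype.card ι * (|ε| * B) / κ') * (Fintype.card ι * (2 / Real.sqrt (Real.pi * κ'))) +
          (2 * n + 1) * (|ε| * B / (4 * κ')) * (8 * ((2 * n + 1) * (Fintype.card ι * (|ε| * B / (4 * κ')))) + Fintype.card ι * (|ε| * B) / κ')) ≤
      ∫ p, min 1 (Real.exp (-((S (sunLeapfrogProposalN pauliCoordι pauliCoordι_skew ε (fun (W : ι → Matrix.specialUnitaryGroup (Fin 2) ℂ) (l : ι) =>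
          -(ε / (4 * κ')) • WithLp.toLp 2 (fun i : Fin 3 => fderiv ℝ (fun a : ι → EuclideanSpace ℝ (Fin 3) => S ((fun l : ι => expPauli (a l)) * W)) 0
            (Pi.single l (EuclideanSpace.single i (1 : ℝ))))) n (q, p)).1 +
        su2Kinetic κ' (sunLeapfrogProposalN pauliCoordι pauliCoordι_skew ε (fun (W : ι → Matrix.specialUnitaryGroup (Fin 2) ℂ) (l : ι) =>
          -(ε / (4 * κ')) • WithLp.toLp 2 (fun i : Fin 3 => fderiv ℝ (fun a : ι → EuclideanSpace ℝ (Fin 3) => S ((fun l : ι => expPauli (a l)) * W)) 0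
            (Pi.single l (EuclideanSpace.single i (1 : ℝ))))) n (q, p)).2) - (S q + su2Kinetic κ' p))))
        ∂(su2MomentumLaw (ι := ι) κ') := by
  -- the hypotheses of `su2LeapfrogProposalN_meanAcceptance_ge` for `D^ε S = ε·D¹S`
  have hd : ∀ W : ι → Matrix.specialUnitaryGroup (Fin 2) ℂ,
      DifferentiableAt ℝ (fun a : ι → EuclideanSpace ℝ (Fin 3) => S (su2ExpDrift ε a * W)) 0 :=
    fun W => differentiableAt_action_su2ExpDrift S ε W (hd1 W)
  have hgrad := fun W => su2Grad_eq_smul_unitGrad S ε W (hd1 W)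
  have hfun : (fun (W : ι → Matrix.specialUnitaryGroup (Fin 2) ℂ) (l : ι) =>
        WithLp.toLp 2 (fun i : Fin 3 => fderiv ℝ (fun a : ι → EuclideanSpace ℝ (Fin 3) => S (su2ExpDrift ε a * W)) 0
          (Pi.single l (EuclideanSpace.single i (1 : ℝ))))) =
      ε • (fun (W : ι → Matrix.specialUnitaryGroup (Fin 2) ℂ) (l : ι) =>
        WithLp.toLp 2 (fun i : Fin 3 => fderiv ℝ (fun a : ι → EuclideanSpace ℝ (Fin 3) => S ((fun l : ι => expPauli (a l)) * W)) 0
          (Pi.single l (EuclideanSpace.single i (1 : ℝ))))) := by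
    funext W l
    rw [Pi.smul_apply, Pi.smul_apply, hgrad W l]
  have hDm : Measurable (fun (W : ι → Matrix.specialUnitaryGroup (Fin 2) ℂ) (l : ι) =>
      WithLp.toLp 2 (fun i : Fin 3 => fderiv ℝ (fun a : ι → EuclideanSpace ℝ (Fin 3) => S (su2ExpDrift ε a * W)) 0
        (Pi.single l (EuclideanSpace.single i (1 : ℝ))))) := by
    rw [hfun]
    exact hm1.const_smul ε
  have hDb : ∀ (W : ι → Matrix.specialUnitaryGroup (Fin 2) ℂ) (l : ι),
      ‖WithLp.toLp 2 (fun i : Fin 3 => fderiv ℝ (fun a : ι → EuclideanSpace ℝ (Fin 3) => S (su2ExpDrift ε a * W)) 0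
        (Pi.single l (EuclideanSpace.single i (1 : ℝ))))‖ ≤ |ε| * B := by
    intro W l
    rw [hgrad W l, norm_smul, Real.norm_eq_abs]
    exact mul_le_mul_of_nonneg_left (hb W l) (abs_nonneg ε)
  have hfunW : ∀ W : ι → Matrix.specialUnitaryGroup (Fin 2) ℂ,
      (fun l : ι => WithLp.toLp 2 (fun i : Fin 3 => fderiv ℝ (fun a : ι → EuclideanSpace ℝ (Fin 3) => S (su2ExpDrift ε a * W)) 0
          (Pi.single l (EuclideanSpace.single i (1 : ℝ))))) =
        ε • (fun l : ι => WithLp.toLp 2 (fun i : Fin 3 => fderiv ℝ (fun a : ι → EuclideanSpace ℝ (Fin 3) => S ((fun l : ι => expPauli (a l)) * W)) 0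
          (Pi.single l (EuclideanSpace.single i (1 : ℝ))))) := by
    intro W
    funext l
    rw [Pi.smul_apply, hgrad W l]
  have hDK : ∀ W W' : ι → Matrix.specialUnitaryGroup (Fin 2) ℂ,
      ‖(fun l : ι => WithLp.toLp 2 (fun i : Fin 3 => fderiv ℝ (fun a : ι → EuclideanSpace ℝ (Fin 3) => S (su2ExpDrift ε a * W)) 0
          (Pi.single l (EuclideanSpace.single i (1 : ℝ))))) -
        (fun l : ι => WithLp.toLp 2 (fun i : Fin 3 => fderiv ℝ (fun a : ι → EuclideanSpace ℝ (Fin 3) => S (su2ExpDrift ε a * W')) 0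
          (Pi.single l (EuclideanSpace.single i (1 : ℝ)))))‖ ≤ (|ε| * K) * ‖coeConfig W - coeConfig W'‖ := by
    intro W W'
    rw [hfunW W, hfunW W', ← smul_sub, norm_smul, Real.norm_eq_abs, mul_assoc]
    exact mul_le_mul_of_nonneg_left (hK W W') (abs_nonneg ε)
  have hkick : (fun (W : ι → Matrix.specialUnitaryGroup (Fin 2) ℂ) (l : ι) =>
        -(1 / (4 * κ')) • WithLp.toLp 2 (fun i : Fin 3 => fderiv ℝ (fun a : ι → EuclideanSpace ℝ (Fin 3) => S (su2ExpDrift ε a * W)) 0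
          (Pi.single l (EuclideanSpace.single i (1 : ℝ))))) =
      (fun (W : ι → Matrix.specialUnitaryGroup (Fin 2) ℂ) (l : ι) =>
        -(ε / (4 * κ')) • WithLp.toLp 2 (fun i : Fin 3 => fderiv ℝ (fun a : ι → EuclideanSpace ℝ (Fin 3) => S ((fun l : ι => expPauli (a l)) * W)) 0
          (Pi.single l (EuclideanSpace.single i (1 : ℝ))))) := by
    funext W l
    rw [hgrad W l, smul_smul]
    congr 1
    ring
  have h := su2LeapfrogProposalN_meanAcceptance_ge S ε κ' hκ' hS hd (by positivity : 0 ≤ |ε| * B)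
    (by positivity : 0 ≤ |ε| * K) hDm hDb hDK q n
  rw [hkick] at h
  exact h

end UnitForce

/-! ## §2 The LO Wilson-flow member on any torus, any schedule -/

section Member

variable {d L : ℕ} {X : Type*} [DecidableEq X] (χ : Site d L → X) [NeZero L]

/-- **THE MEAN ACCEPTANCE OF FT-HMC THROUGH THE `SU(2)` LO MEMBER WITH THE EXACT FORCE AS RUN.**  Torus `(ℤ/L)^d`,
colouring `χ`, ANY schedule (layers packaged VERBATIM, positive densities), every `β`, `κ' > 0`: there are
`Φ_max, K_Φ ≥ 0` such that for EVERY `n`, `ε'`, `q` the refresh-averaged Metropolis acceptance of the engine's `n`-step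
proposal with drift `e_{ε'}` and the consistent half kick `−(ε'/(4κ'))·D¹S̃` is at least
`1 − n·(|ε'|K_Φ)·|ε'|·(8|E|²·3/(2κ') + (8b + 8c₁ + c₂)·|E|·2/√(πκ') + b(8c₁ + c₂))`,
`b = (2n+1)|ε'|Φ_max/(4κ')`, `c₁ = (2n+1)|E||ε'|Φ_max/(4κ')`, `c₂ = |E||ε'|Φ_max/κ'`. -/
theorem su2WilsonFlowLO_exactForce_meanAcceptance_ge (ε : ℝ) (sched : List (Fin d × X))
    (layers : List ((GaugeConfig d L (Matrix.specialUnitaryGroup (Fin 2) ℂ) ≃ᵐ GaugeConfig d L (Matrix.specialUnitaryGroup (Fin 2) ℂ)) × (GaugeConfig d L (Matrix.specialUnitaryGroup (Fin 2) ℂ) → ℝ)))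
    (hmap :
      layers.map (fun Ly => ((Ly.1 : GaugeConfig d L (Matrix.specialUnitaryGroup (Fin 2) ℂ) → GaugeConfig d L (Matrix.specialUnitaryGroup (Fin 2) ℂ)), Ly.2)) =
        sched.map (fun s =>
        ((fun (V : GaugeConfig d L (Matrix.specialUnitaryGroup (Fin 2) ℂ)) (e : Edge d L) =>
        if e.2 = s.1 ∧ χ e.1 = s.2 then
          gaussUnit (geodesicKick ε (∑ ν ∈ Finset.univ.erase e.2,
            (vecQuat (((V (Site.shift e.1 e.2, ν) * (V (Site.shift e.1 ν, e.2))⁻¹ * (V (e.1, ν))⁻¹)⁻¹ : (Matrix.specialUnitaryGroup (Fin 2) ℂ)) : Matrix (Fin 2) (Fin 2) ℂ) +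
              vecQuat ((((V (Site.shift (e.1 - Pi.single ν 1) e.2, ν))⁻¹ * (V (e.1 - Pi.single ν 1, e.2))⁻¹ *
                V (e.1 - Pi.single ν 1, ν))⁻¹ : (Matrix.specialUnitaryGroup (Fin 2) ℂ)) : Matrix (Fin 2) (Fin 2) ℂ)))
            (vecQuat ((V e : (Matrix.specialUnitaryGroup (Fin 2) ℂ)) : Matrix (Fin 2) (Fin 2) ℂ)))
        else V e),
         fun V : GaugeConfig d L (Matrix.specialUnitaryGroup (Fin 2) ℂ) => ∏ a : {e : Edge d L // e.2 = s.1 ∧ χ e.1 = s.2},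
          (if Real.sin (angle (∑ ν ∈ Finset.univ.erase a.1.2,
            (vecQuat (((V (Site.shift a.1.1 a.1.2, ν) * (V (Site.shift a.1.1 ν, a.1.2))⁻¹ * (V (a.1.1, ν))⁻¹)⁻¹ : (Matrix.specialUnitaryGroup (Fin 2) ℂ)) : Matrix (Fin 2) (Fin 2) ℂ) +
              vecQuat ((((V (Site.shift (a.1.1 - Pi.single ν 1) a.1.2, ν))⁻¹ * (V (a.1.1 - Pi.single ν 1, a.1.2))⁻¹ *
                V (a.1.1 - Pi.single ν 1, ν))⁻¹ : (Matrix.specialUnitaryGroup (Fin 2) ℂ)) : Matrix (Fin 2) (Fin 2) ℂ))) (vecQuat ((V a.1 : (Matrix.specialUnitaryGroup (Fin 2) ℂ)) : Matrix (Fin 2) (Fin 2) ℂ))) = 0 then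
            (1 - ε * ‖(∑ ν ∈ Finset.univ.erase a.1.2,
            (vecQuat (((V (Site.shift a.1.1 a.1.2, ν) * (V (Site.shift a.1.1 ν, a.1.2))⁻¹ * (V (a.1.1, ν))⁻¹)⁻¹ : (Matrix.specialUnitaryGroup (Fin 2) ℂ)) : Matrix (Fin 2) (Fin 2) ℂ) +
              vecQuat ((((V (Site.shift (a.1.1 - Pi.single ν 1) a.1.2, ν))⁻¹ * (V (a.1.1 - Pi.single ν 1, a.1.2))⁻¹ *
                V (a.1.1 - Pi.single ν 1, ν))⁻¹ : (Matrix.specialUnitaryGroup (Fin 2) ℂ)) : Matrix (Fin 2) (Fin 2) ℂ)))‖ * Real.cos (angle (∑ ν ∈ Finset.univ.erase a.1.2,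
            (vecQuat (((V (Site.shift a.1.1 a.1.2, ν) * (V (Site.shift a.1.1 ν, a.1.2))⁻¹ * (V (a.1.1, ν))⁻¹)⁻¹ : (Matrix.specialUnitaryGroup (Fin 2) ℂ)) : Matrix (Fin 2) (Fin 2) ℂ) +
              vecQuat ((((V (Site.shift (a.1.1 - Pi.single ν 1) a.1.2, ν))⁻¹ * (V (a.1.1 - Pi.single ν 1, a.1.2))⁻¹ *
                V (a.1.1 - Pi.single ν 1, ν))⁻¹ : (Matrix.specialUnitaryGroup (Fin 2) ℂ)) : Matrix (Fin 2) (Fin 2) ℂ))) (vecQuat ((V a.1 : (Matrix.specialUnitaryGroup (Fin 2) ℂ)) : Matrix (Fin 2) (Fin 2) ℂ)))) ^ 3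
          else kickJac (ε * ‖(∑ ν ∈ Finset.univ.erase a.1.2,
            (vecQuat (((V (Site.shift a.1.1 a.1.2, ν) * (V (Site.shift a.1.1 ν, a.1.2))⁻¹ * (V (a.1.1, ν))⁻¹)⁻¹ : (Matrix.specialUnitaryGroup (Fin 2) ℂ)) : Matrix (Fin 2) (Fin 2) ℂ) +
              vecQuat ((((V (Site.shift (a.1.1 - Pi.single ν 1) a.1.2, ν))⁻¹ * (V (a.1.1 - Pi.single ν 1, a.1.2))⁻¹ *
                V (a.1.1 - Pi.single ν 1, ν))⁻¹ : (Matrix.specialUnitaryGroup (Fin 2) ℂ)) : Matrix (Fin 2) (Fin 2) ℂ)))‖) 2 (angle (∑ ν ∈ Finset.univ.erase a.1.2,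
            (vecQuat (((V (Site.shift a.1.1 a.1.2, ν) * (V (Site.shift a.1.1 ν, a.1.2))⁻¹ * (V (a.1.1, ν))⁻¹)⁻¹ : (Matrix.specialUnitaryGroup (Fin 2) ℂ)) : Matrix (Fin 2) (Fin 2) ℂ) +
              vecQuat ((((V (Site.shift (a.1.1 - Pi.single ν 1) a.1.2, ν))⁻¹ * (V (a.1.1 - Pi.single ν 1, a.1.2))⁻¹ *
                V (a.1.1 - Pi.single ν 1, ν))⁻¹ : (Matrix.specialUnitaryGroup (Fin 2) ℂ)) : Matrix (Fin 2) (Fin 2) ℂ))) (vecQuat ((V a.1 : (Matrix.specialUnitaryGroup (Fin 2) ℂ)) : Matrix (Fin 2) (Fin 2) ℂ)))))))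
    (hpos : ∀ Ly ∈ layers, ∀ V, 0 < Ly.2 V) (β κ' : ℝ) (hκ' : 0 < κ') :
    ∃ Φmax KΦ : ℝ, 0 ≤ Φmax ∧ 0 ≤ KΦ ∧
      ∀ (n : ℕ) (ε' : ℝ) (q : GaugeConfig d L (Matrix.specialUnitaryGroup (Fin 2) ℂ)),
        1 - n * ((|ε'| * KΦ) * |ε'|) *
            (8 * ((Fintype.card (Edge d L) : ℝ) ^ 2 * (3 / (2 * κ'))) +
              (8 * ((2 * n + 1) * (|ε'| * Φmax / (4 * κ'))) + 8 * ((2 * n + 1) * (Fintype.card (Edge d L) * (|ε'| * Φmax / (4 * κ')))) +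
                  Fintype.card (Edge d L) * (|ε'| * Φmax) / κ') * (Fintype.card (Edge d L) * (2 / Real.sqrt (Real.pi * κ'))) +
              (2 * n + 1) * (|ε'| * Φmax / (4 * κ')) *
                (8 * ((2 * n + 1) * (Fintype.card (Edge d L) * (|ε'| * Φmax / (4 * κ')))) + Fintype.card (Edge d L) * (|ε'| * Φmax) / κ')) ≤
          ∫ p, min 1 (Real.exp (-((β * wilsonAction (Matrix.specialUnitaryGroup (Fin 2) ℂ).subtype ((layers.foldr (fun Ly (F : GaugeConfig d L (Matrix.specialUnitaryGroup (Fin 2) ℂ) ≃ᵐ GaugeConfig d L (Matrix.specialUnitaryGroup (Fin 2) ℂ)) => Ly.1.trans F) (MeasurableEquiv.refl (GaugeConfig d L (Matrix.specialUnitaryGroup (Fin 2) ℂ)))) (sunLeapfrogProposalN pauliCoordι pauliCoordι_skew ε' (fun (V : GaugeConfig d L (Matrix.specialUnitaryGroup (Fin 2) ℂ)) (l : Edge d L) => -(ε' / (4 * κ')) • WithLp.toLp 2 (fun i : Fin 3 =>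
        fderiv ℝ (fun a : Edge d L → EuclideanSpace ℝ (Fin 3) => β * wilsonAction (Matrix.specialUnitaryGroup (Fin 2) ℂ).subtype ((layers.foldr (fun Ly (F : GaugeConfig d L (Matrix.specialUnitaryGroup (Fin 2) ℂ) ≃ᵐ GaugeConfig d L (Matrix.specialUnitaryGroup (Fin 2) ℂ)) => Ly.1.trans F) (MeasurableEquiv.refl (GaugeConfig d L (Matrix.specialUnitaryGroup (Fin 2) ℂ)))) ((fun l : Edge d L => expPauli (a l)) * V)) - Real.log ((layers.foldr (fun Ly K => fun v => Ly.2 v * K (Ly.1 v)) (fun _ => (1 : ℝ))) ((fun l : Edge d L => expPauli (a l)) * V))) 0 (Pi.single l (EuclideanSpace.single i (1 : ℝ))))) n (q, p)).1) - Real.log ((layers.foldr (fun Ly K => fun v => Ly.2 v * K (Ly.1 v)) (fun _ => (1 : ℝ))) (sunLeapfrogProposalN pauliCoordι pauliCoordι_skew ε' (fun (V : GaugeConfig d L (Matrix.specialUnitaryGroup (Fin 2) ℂ)) (l : Edge d L) => -(ε' / (4 * κ')) • WithLp.toLp 2 (fun i : Fin 3 =>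
        fderiv ℝ (fun a : Edge d L → EuclideanSpace ℝ (Fin 3) => β * wilsonAction (Matrix.specialUnitaryGroup (Fin 2) ℂ).subtype ((layers.foldr (fun Ly (F : GaugeConfig d L (Matrix.specialUnitaryGroup (Fin 2) ℂ) ≃ᵐ GaugeConfig d L (Matrix.specialUnitaryGroup (Fin 2) ℂ)) => Ly.1.trans F) (MeasurableEquiv.refl (GaugeConfig d L (Matrix.specialUnitaryGroup (Fin 2) ℂ)))) ((fun l : Edge d L => expPauli (a l)) * V)) - Real.log ((layers.foldr (fun Ly K => fun v => Ly.2 v * K (Ly.1 v)) (fun _ => (1 : ℝ))) ((fun l : Edge d L => expPauli (a l)) * V))) 0 (Pi.single l (EuclideanSpace.single i (1 : ℝ))))) n (q, p)).1) + su2Kinetic κ' (sunLeapfrogProposalN pauliCoordι pauliCoordι_skew ε' (fun (V : GaugeConfig d L (Matrix.specialUnitaryGroup (Fin 2) ℂ)) (l : Edge d L) => -(ε' / (4 * κ')) • WithLp.toLp 2 (fun i : Fin 3 =>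
        fderiv ℝ (fun a : Edge d L → EuclideanSpace ℝ (Fin 3) => β * wilsonAction (Matrix.specialUnitaryGroup (Fin 2) ℂ).subtype ((layers.foldr (fun Ly (F : GaugeConfig d L (Matrix.specialUnitaryGroup (Fin 2) ℂ) ≃ᵐ GaugeConfig d L (Matrix.specialUnitaryGroup (Fin 2) ℂ)) => Ly.1.trans F) (MeasurableEquiv.refl (GaugeConfig d L (Matrix.specialUnitaryGroup (Fin 2) ℂ)))) ((fun l : Edge d L => expPauli (a l)) * V)) - Real.log ((layers.foldr (fun Ly K => fun v => Ly.2 v * K (Ly.1 v)) (fun _ => (1 : ℝ))) ((fun l : Edge d L => expPauli (a l)) * V))) 0 (Pi.single l (EuclideanSpace.single i (1 : ℝ))))) n (q, p)).2) -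
            (β * wilsonAction (Matrix.specialUnitaryGroup (Fin 2) ℂ).subtype ((layers.foldr (fun Ly (F : GaugeConfig d L (Matrix.specialUnitaryGroup (Fin 2) ℂ) ≃ᵐ GaugeConfig d L (Matrix.specialUnitaryGroup (Fin 2) ℂ)) => Ly.1.trans F) (MeasurableEquiv.refl (GaugeConfig d L (Matrix.specialUnitaryGroup (Fin 2) ℂ)))) q) - Real.log ((layers.foldr (fun Ly K => fun v => Ly.2 v * K (Ly.1 v)) (fun _ => (1 : ℝ))) q) + su2Kinetic κ' p)))) ∂(su2MomentumLaw (ι := Edge d L) κ') := by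
  obtain ⟨hΦm₁, Φmax, KΦ, hΦ0, hK0, hb₁, hK₁⟩ := su2WilsonFlowLO_exactForce_regular χ ε sched layers hmap hpos β 1
  have hm1 : Measurable (fun (V : GaugeConfig d L (Matrix.specialUnitaryGroup (Fin 2) ℂ)) (l : Edge d L) => WithLp.toLp 2 (fun i : Fin 3 =>
        fderiv ℝ (fun a : Edge d L → EuclideanSpace ℝ (Fin 3) => β * wilsonAction (Matrix.specialUnitaryGroup (Fin 2) ℂ).subtype ((layers.foldr (fun Ly (F : GaugeConfig d L (Matrix.specialUnitaryGroup (Fin 2) ℂ) ≃ᵐ GaugeConfig d L (Matrix.specialUnitaryGroup (Fin 2) ℂ)) => Ly.1.trans F) (MeasurableEquiv.refl (GaugeConfig d L (Matrix.specialUnitaryGroup (Fin 2) ℂ)))) ((fun l : Edge d L => expPauli (a l)) * V)) - Real.log ((layers.foldr (fun Ly K => fun v => Ly.2 v * K (Ly.1 v)) (fun _ => (1 : ℝ))) ((fun l : Edge d L => expPauli (a l)) * V))) 0 (Pi.single l (EuclideanSpace.single i (1 : ℝ))))) := by simpa only [one_smul] using hΦm₁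
  have hb : ∀ (V : GaugeConfig d L (Matrix.specialUnitaryGroup (Fin 2) ℂ)) (l : Edge d L), ‖WithLp.toLp 2 (fun i : Fin 3 =>
        fderiv ℝ (fun a : Edge d L → EuclideanSpace ℝ (Fin 3) => β * wilsonAction (Matrix.specialUnitaryGroup (Fin 2) ℂ).subtype ((layers.foldr (fun Ly (F : GaugeConfig d L (Matrix.specialUnitaryGroup (Fin 2) ℂ) ≃ᵐ GaugeConfig d L (Matrix.specialUnitaryGroup (Fin 2) ℂ)) => Ly.1.trans F) (MeasurableEquiv.refl (GaugeConfig d L (Matrix.specialUnitaryGroup (Fin 2) ℂ)))) ((fun l : Edge d L => expPauli (a l)) * V)) - Real.log ((layers.foldr (fun Ly K => fun v => Ly.2 v * K (Ly.1 v)) (fun _ => (1 : ℝ))) ((fun l : Edge d L => expPauli (a l)) * V))) 0 (Pi.single l (EuclideanSpace.single i (1 : ℝ))))‖ ≤ Φmax :=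
    fun V l => by simpa only [one_smul] using hb₁ V l
  have hK : ∀ V V' : GaugeConfig d L (Matrix.specialUnitaryGroup (Fin 2) ℂ),
      ‖(fun l : Edge d L => WithLp.toLp 2 (fun i : Fin 3 =>
        fderiv ℝ (fun a : Edge d L → EuclideanSpace ℝ (Fin 3) => β * wilsonAction (Matrix.specialUnitaryGroup (Fin 2) ℂ).subtype ((layers.foldr (fun Ly (F : GaugeConfig d L (Matrix.specialUnitaryGroup (Fin 2) ℂ) ≃ᵐ GaugeConfig d L (Matrix.specialUnitaryGroup (Fin 2) ℂ)) => Ly.1.trans F) (MeasurableEquiv.refl (GaugeConfig d L (Matrix.specialUnitaryGroup (Fin 2) ℂ)))) ((fun l : Edge d L => expPauli (a l)) * V)) - Real.log ((layers.foldr (fun Ly K => fun v => Ly.2 v * K (Ly.1 v)) (fun _ => (1 : ℝ))) ((fun l : Edge d L => expPauli (a l)) * V))) 0 (Pi.single l (EuclideanSpace.single i (1 : ℝ))))) - (fun l : Edge d L => WithLp.toLp 2 (fun i : Fin 3 =>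
        fderiv ℝ (fun a : Edge d L → EuclideanSpace ℝ (Fin 3) => β * wilsonAction (Matrix.specialUnitaryGroup (Fin 2) ℂ).subtype ((layers.foldr (fun Ly (F : GaugeConfig d L (Matrix.specialUnitaryGroup (Fin 2) ℂ) ≃ᵐ GaugeConfig d L (Matrix.specialUnitaryGroup (Fin 2) ℂ)) => Ly.1.trans F) (MeasurableEquiv.refl (GaugeConfig d L (Matrix.specialUnitaryGroup (Fin 2) ℂ)))) ((fun l : Edge d L => expPauli (a l)) * V')) - Real.log ((layers.foldr (fun Ly K => fun v => Ly.2 v * K (Ly.1 v)) (fun _ => (1 : ℝ))) ((fun l : Edge d L => expPauli (a l)) * V'))) 0 (Pi.single l (EuclideanSpace.single i (1 : ℝ)))))‖ ≤ KΦ * ‖coeConfig V - coeConfig V'‖ :=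
    fun V V' => by simpa only [one_smul] using hK₁ V V'
  have hd1 : ∀ W : GaugeConfig d L (Matrix.specialUnitaryGroup (Fin 2) ℂ),
      DifferentiableAt ℝ (fun a : Edge d L → EuclideanSpace ℝ (Fin 3) => β * wilsonAction (Matrix.specialUnitaryGroup (Fin 2) ℂ).subtype ((layers.foldr (fun Ly (F : GaugeConfig d L (Matrix.specialUnitaryGroup (Fin 2) ℂ) ≃ᵐ GaugeConfig d L (Matrix.specialUnitaryGroup (Fin 2) ℂ)) => Ly.1.trans F) (MeasurableEquiv.refl (GaugeConfig d L (Matrix.specialUnitaryGroup (Fin 2) ℂ)))) ((fun l : Edge d L => expPauli (a l)) * W)) - Real.log ((layers.foldr (fun Ly K => fun v => Ly.2 v * K (Ly.1 v)) (fun _ => (1 : ℝ))) ((fun l : Edge d L => expPauli (a l)) * W))) 0 :=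
    fun W => differentiableAt_ftAction_su2WilsonFlowLO_pauliDrift χ ε sched layers hmap hpos β W 0
  have hρ : Continuous ⇑((Matrix.specialUnitaryGroup (Fin 2) ℂ).subtype) := continuous_subtype_val
  have hS0c : Continuous fun U : GaugeConfig d L (Matrix.specialUnitaryGroup (Fin 2) ℂ) =>
      β * wilsonAction (Matrix.specialUnitaryGroup (Fin 2) ℂ).subtype U := continuous_smul_wilsonAction _ hρ β
  have hSc := su2WilsonFlowLO_member_ftAction_continuous χ ε sched layers hmap hpos hS0c
  refine ⟨Φmax, KΦ, hΦ0, hK0, fun n ε' q => ?_⟩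
  exact su2LeapfrogProposalN_meanAcceptance_ge_of_unitGrad
    (fun V : GaugeConfig d L (Matrix.specialUnitaryGroup (Fin 2) ℂ) => β * wilsonAction (Matrix.specialUnitaryGroup (Fin 2) ℂ).subtype ((layers.foldr (fun Ly (F : GaugeConfig d L (Matrix.specialUnitaryGroup (Fin 2) ℂ) ≃ᵐ GaugeConfig d L (Matrix.specialUnitaryGroup (Fin 2) ℂ)) => Ly.1.trans F) (MeasurableEquiv.refl (GaugeConfig d L (Matrix.specialUnitaryGroup (Fin 2) ℂ)))) V) - Real.log ((layers.foldr (fun Ly K => fun v => Ly.2 v * K (Ly.1 v)) (fun _ => (1 : ℝ))) V)) ε' κ' hκ' hSc.measurable hd1 hΦ0 hK0 hm1 hb hK q n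

end Member

/-! ## §3 The row's 4⁴ acceptance configuration -/

section Acceptance

/-- **THE ROW'S ACCEPTANCE CONFIGURATION: the mean acceptance of FT-HMC through the LO member with the exact force is
`≥ 1 − O(nε'²)`.**  4⁴ `SU(2)`, a parity colouring, Lüscher's sweep schedule (`8·nsweeps` masked LO sub-steps),
refusal rule `6|ε| < 1`, every `β`, `κ' > 0`: the layers exist as packaged, and the conclusion of
`su2WilsonFlowLO_exactForce_meanAcceptance_ge` holds for them (`|E| = |Edge 4 4|`). -/
theorem su2_fthmcN_acceptanceLattice_exactForce_meanAcceptance_ge {ε : ℝ} (hε : |ε| * 6 < 1)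
    (nsweeps : ℕ) (β κ' : ℝ) (hκ' : 0 < κ') :
    ∃ χ : Site 4 4 → ZMod 2, (∀ (x : Site 4 4) (i : Fin 4), χ (x.shift i) ≠ χ x) ∧
    ∃ layers : List ((GaugeConfig 4 4 (Matrix.specialUnitaryGroup (Fin 2) ℂ) ≃ᵐ GaugeConfig 4 4 (Matrix.specialUnitaryGroup (Fin 2) ℂ)) × (GaugeConfig 4 4 (Matrix.specialUnitaryGroup (Fin 2) ℂ) → ℝ)),
      layers.map (fun Ly => ((Ly.1 : GaugeConfig 4 4 (Matrix.specialUnitaryGroup (Fin 2) ℂ) → GaugeConfig 4 4 (Matrix.specialUnitaryGroup (Fin 2) ℂ)), Ly.2)) =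
        ((List.replicate nsweeps ((List.finRange 4).flatMap fun μ : Fin 4 => [(μ, (0 : ZMod 2)), (μ, 1)])).flatten).map (fun s =>
        ((fun (V : GaugeConfig 4 4 (Matrix.specialUnitaryGroup (Fin 2) ℂ)) (e : Edge 4 4) =>
        if e.2 = s.1 ∧ χ e.1 = s.2 then
          gaussUnit (geodesicKick ε (∑ ν ∈ Finset.univ.erase e.2,
            (vecQuat (((V (Site.shift e.1 e.2, ν) * (V (Site.shift e.1 ν, e.2))⁻¹ * (V (e.1, ν))⁻¹)⁻¹ : (Matrix.specialUnitaryGroup (Fin 2) ℂ)) : Matrix (Fin 2) (Fin 2) ℂ) +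
              vecQuat ((((V (Site.shift (e.1 - Pi.single ν 1) e.2, ν))⁻¹ * (V (e.1 - Pi.single ν 1, e.2))⁻¹ *
                V (e.1 - Pi.single ν 1, ν))⁻¹ : (Matrix.specialUnitaryGroup (Fin 2) ℂ)) : Matrix (Fin 2) (Fin 2) ℂ)))
            (vecQuat ((V e : (Matrix.specialUnitaryGroup (Fin 2) ℂ)) : Matrix (Fin 2) (Fin 2) ℂ)))
        else V e),
         fun V : GaugeConfig 4 4 (Matrix.specialUnitaryGroup (Fin 2) ℂ) => ∏ a : {e : Edge 4 4 // e.2 = s.1 ∧ χ e.1 = s.2},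
          (if Real.sin (angle (∑ ν ∈ Finset.univ.erase a.1.2,
            (vecQuat (((V (Site.shift a.1.1 a.1.2, ν) * (V (Site.shift a.1.1 ν, a.1.2))⁻¹ * (V (a.1.1, ν))⁻¹)⁻¹ : (Matrix.specialUnitaryGroup (Fin 2) ℂ)) : Matrix (Fin 2) (Fin 2) ℂ) +
              vecQuat ((((V (Site.shift (a.1.1 - Pi.single ν 1) a.1.2, ν))⁻¹ * (V (a.1.1 - Pi.single ν 1, a.1.2))⁻¹ *
                V (a.1.1 - Pi.single ν 1, ν))⁻¹ : (Matrix.specialUnitaryGroup (Fin 2) ℂ)) : Matrix (Fin 2) (Fin 2) ℂ))) (vecQuat ((V a.1 : (Matrix.specialUnitaryGroup (Fin 2) ℂ)) : Matrix (Fin 2) (Fin 2) ℂ))) = 0 then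
            (1 - ε * ‖(∑ ν ∈ Finset.univ.erase a.1.2,
            (vecQuat (((V (Site.shift a.1.1 a.1.2, ν) * (V (Site.shift a.1.1 ν, a.1.2))⁻¹ * (V (a.1.1, ν))⁻¹)⁻¹ : (Matrix.specialUnitaryGroup (Fin 2) ℂ)) : Matrix (Fin 2) (Fin 2) ℂ) +
              vecQuat ((((V (Site.shift (a.1.1 - Pi.single ν 1) a.1.2, ν))⁻¹ * (V (a.1.1 - Pi.single ν 1, a.1.2))⁻¹ *
                V (a.1.1 - Pi.single ν 1, ν))⁻¹ : (Matrix.specialUnitaryGroup (Fin 2) ℂ)) : Matrix (Fin 2) (Fin 2) ℂ)))‖ * Real.cos (angle (∑ ν ∈ Finset.univ.erase a.1.2,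
            (vecQuat (((V (Site.shift a.1.1 a.1.2, ν) * (V (Site.shift a.1.1 ν, a.1.2))⁻¹ * (V (a.1.1, ν))⁻¹)⁻¹ : (Matrix.specialUnitaryGroup (Fin 2) ℂ)) : Matrix (Fin 2) (Fin 2) ℂ) +
              vecQuat ((((V (Site.shift (a.1.1 - Pi.single ν 1) a.1.2, ν))⁻¹ * (V (a.1.1 - Pi.single ν 1, a.1.2))⁻¹ *
                V (a.1.1 - Pi.single ν 1, ν))⁻¹ : (Matrix.specialUnitaryGroup (Fin 2) ℂ)) : Matrix (Fin 2) (Fin 2) ℂ))) (vecQuat ((V a.1 : (Matrix.specialUnitaryGroup (Fin 2) ℂ)) : Matrix (Fin 2) (Fin 2) ℂ)))) ^ 3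
          else kickJac (ε * ‖(∑ ν ∈ Finset.univ.erase a.1.2,
            (vecQuat (((V (Site.shift a.1.1 a.1.2, ν) * (V (Site.shift a.1.1 ν, a.1.2))⁻¹ * (V (a.1.1, ν))⁻¹)⁻¹ : (Matrix.specialUnitaryGroup (Fin 2) ℂ)) : Matrix (Fin 2) (Fin 2) ℂ) +
              vecQuat ((((V (Site.shift (a.1.1 - Pi.single ν 1) a.1.2, ν))⁻¹ * (V (a.1.1 - Pi.single ν 1, a.1.2))⁻¹ *
                V (a.1.1 - Pi.single ν 1, ν))⁻¹ : (Matrix.specialUnitaryGroup (Fin 2) ℂ)) : Matrix (Fin 2) (Fin 2) ℂ)))‖) 2 (angle (∑ ν ∈ Finset.univ.erase a.1.2,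
            (vecQuat (((V (Site.shift a.1.1 a.1.2, ν) * (V (Site.shift a.1.1 ν, a.1.2))⁻¹ * (V (a.1.1, ν))⁻¹)⁻¹ : (Matrix.specialUnitaryGroup (Fin 2) ℂ)) : Matrix (Fin 2) (Fin 2) ℂ) +
              vecQuat ((((V (Site.shift (a.1.1 - Pi.single ν 1) a.1.2, ν))⁻¹ * (V (a.1.1 - Pi.single ν 1, a.1.2))⁻¹ *
                V (a.1.1 - Pi.single ν 1, ν))⁻¹ : (Matrix.specialUnitaryGroup (Fin 2) ℂ)) : Matrix (Fin 2) (Fin 2) ℂ))) (vecQuat ((V a.1 : (Matrix.specialUnitaryGroup (Fin 2) ℂ)) : Matrix (Fin 2) (Fin 2) ℂ)))))) ∧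
      layers.length = 8 * nsweeps ∧ (∀ Ly ∈ layers, ∀ V, 0 < Ly.2 V) ∧
    ∃ Φmax KΦ : ℝ, 0 ≤ Φmax ∧ 0 ≤ KΦ ∧
      ∀ (n : ℕ) (ε' : ℝ) (q : GaugeConfig 4 4 (Matrix.specialUnitaryGroup (Fin 2) ℂ)),
        1 - n * ((|ε'| * KΦ) * |ε'|) *
            (8 * ((Fintype.card (Edge 4 4) : ℝ) ^ 2 * (3 / (2 * κ'))) +
              (8 * ((2 * n + 1) * (|ε'| * Φmax / (4 * κ'))) + 8 * ((2 * n + 1) * (Fintype.card (Edge 4 4) * (|ε'| * Φmax / (4 * κ')))) +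
                  Fintype.card (Edge 4 4) * (|ε'| * Φmax) / κ') * (Fintype.card (Edge 4 4) * (2 / Real.sqrt (Real.pi * κ'))) +
              (2 * n + 1) * (|ε'| * Φmax / (4 * κ')) *
                (8 * ((2 * n + 1) * (Fintype.card (Edge 4 4) * (|ε'| * Φmax / (4 * κ')))) + Fintype.card (Edge 4 4) * (|ε'| * Φmax) / κ')) ≤
          ∫ p, min 1 (Real.exp (-((β * wilsonAction (Matrix.specialUnitaryGroup (Fin 2) ℂ).subtype ((layers.foldr (fun Ly (F : GaugeConfig 4 4 (Matrix.specialUnitaryGroup (Fin 2) ℂ) ≃ᵐ GaugeConfig 4 4 (Matrix.specialUnitaryGroup (Fin 2) ℂ)) => Ly.1.trans F) (MeasurableEquiv.refl (GaugeConfig 4 4 (Matrix.specialUnitaryGroup (Fin 2) ℂ)))) (sunLeapfrogProposalN pauliCoordι pauliCoordι_skew ε' (fun (V : GaugeConfig 4 4 (Matrix.specialUnitaryGroup (Fin 2) ℂ)) (l : Edge 4 4) => -(ε' / (4 * κ')) • WithLp.toLp 2 (fun i : Fin 3 =>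
        fderiv ℝ (fun a : Edge 4 4 → EuclideanSpace ℝ (Fin 3) => β * wilsonAction (Matrix.specialUnitaryGroup (Fin 2) ℂ).subtype ((layers.foldr (fun Ly (F : GaugeConfig 4 4 (Matrix.specialUnitaryGroup (Fin 2) ℂ) ≃ᵐ GaugeConfig 4 4 (Matrix.specialUnitaryGroup (Fin 2) ℂ)) => Ly.1.trans F) (MeasurableEquiv.refl (GaugeConfig 4 4 (Matrix.specialUnitaryGroup (Fin 2) ℂ)))) ((fun l : Edge 4 4 => expPauli (a l)) * V)) - Real.log ((layers.foldr (fun Ly K => fun v => Ly.2 v * K (Ly.1 v)) (fun _ => (1 : ℝ))) ((fun l : Edge 4 4 => expPauli (a l)) * V))) 0 (Pi.single l (EuclideanSpace.single i (1 : ℝ))))) n (q, p)).1) - Real.log ((layers.foldr (fun Ly K => fun v => Ly.2 v * K (Ly.1 v)) (fun _ => (1 : ℝ))) (sunLeapfrogProposalN pauliCoordι pauliCoordι_skew ε' (fun (V : GaugeConfig 4 4 (Matrix.specialUnitaryGroup (Fin 2) ℂ)) (l : Edge 4 4) => -(ε' / (4 * κ')) • WithLp.toLp 2 (fun i : Fin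 3 =>
        fderiv ℝ (fun a : Edge 4 4 → EuclideanSpace ℝ (Fin 3) => β * wilsonAction (Matrix.specialUnitaryGroup (Fin 2) ℂ).subtype ((layers.foldr (fun Ly (F : GaugeConfig 4 4 (Matrix.specialUnitaryGroup (Fin 2) ℂ) ≃ᵐ GaugeConfig 4 4 (Matrix.specialUnitaryGroup (Fin 2) ℂ)) => Ly.1.trans F) (MeasurableEquiv.refl (GaugeConfig 4 4 (Matrix.specialUnitaryGroup (Fin 2) ℂ)))) ((fun l : Edge 4 4 => expPauli (a l)) * V)) - Real.log ((layers.foldr (fun Ly K => fun v => Ly.2 v * K (Ly.1 v)) (fun _ => (1 : ℝ))) ((fun l : Edge 4 4 => expPauli (a l)) * V))) 0 (Pi.single l (EuclideanSpace.single i (1 : ℝ))))) n (q, p)).1) + su2Kinetic κ' (sunLeapfrogProposalN pauliCoordι pauliCoordι_skew ε' (fun (V : GaugeConfig 4 4 (Matrix.specialUnitaryGroup (Fin 2) ℂ)) (l : Edge 4 4) => -(ε' / (4 * κ')) • WithLp.toLp 2 (fun i : Fin 3 =>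
        fderiv ℝ (fun a : Edge 4 4 → EuclideanSpace ℝ (Fin 3) => β * wilsonAction (Matrix.specialUnitaryGroup (Fin 2) ℂ).subtype ((layers.foldr (fun Ly (F : GaugeConfig 4 4 (Matrix.specialUnitaryGroup (Fin 2) ℂ) ≃ᵐ GaugeConfig 4 4 (Matrix.specialUnitaryGroup (Fin 2) ℂ)) => Ly.1.trans F) (MeasurableEquiv.refl (GaugeConfig 4 4 (Matrix.specialUnitaryGroup (Fin 2) ℂ)))) ((fun l : Edge 4 4 => expPauli (a l)) * V)) - Real.log ((layers.foldr (fun Ly K => fun v => Ly.2 v * K (Ly.1 v)) (fun _ => (1 : ℝ))) ((fun l : Edge 4 4 => expPauli (a l)) * V))) 0 (Pi.single l (EuclideanSpace.single i (1 : ℝ))))) n (q, p)).2) -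
            (β * wilsonAction (Matrix.specialUnitaryGroup (Fin 2) ℂ).subtype ((layers.foldr (fun Ly (F : GaugeConfig 4 4 (Matrix.specialUnitaryGroup (Fin 2) ℂ) ≃ᵐ GaugeConfig 4 4 (Matrix.specialUnitaryGroup (Fin 2) ℂ)) => Ly.1.trans F) (MeasurableEquiv.refl (GaugeConfig 4 4 (Matrix.specialUnitaryGroup (Fin 2) ℂ)))) q) - Real.log ((layers.foldr (fun Ly K => fun v => Ly.2 v * K (Ly.1 v)) (fun _ => (1 : ℝ))) q) + su2Kinetic κ' p)))) ∂(su2MomentumLaw (ι := Edge 4 4) κ') := by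
  obtain ⟨χ, hχ⟩ := exists_parityMask (d := 4) (L := 4) (by decide)
  have hε' : |ε| * (2 * ((4 - 1 : ℕ) : ℝ)) < 1 := by norm_num; linarith
  obtain ⟨layers, hmap, hpos, -, -⟩ := exists_layers_su2WilsonFlowLO χ hχ hε'
    ((List.replicate nsweeps ((List.finRange 4).flatMap fun μ : Fin 4 => [(μ, (0 : ZMod 2)), (μ, 1)])).flatten)
  have hlen : layers.length = 8 * nsweeps := by
    have h := congrArg List.length hmap
    rw [List.length_map, List.length_map, length_luscherSchedule_four] at h
    exact h
  exact ⟨χ, hχ, layers, hmap, hlen, hpos,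
    su2WilsonFlowLO_exactForce_meanAcceptance_ge χ ε ((List.replicate nsweeps ((List.finRange 4).flatMap fun μ : Fin 4 => [(μ, (0 : ZMod 2)), (μ, 1)])).flatten) layers hmap hpos β κ' hκ'⟩

end Acceptance

end Summit.Ventures.LatticeQCDFlow.Exactness
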